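import Summits.CriticalPhenomena.PercolationContinuityZ3.Theorems.PercNearOneGluingNoHeavyLowerTailTformSPlusInduction
import HarnessLib

/-!
# `NoHeavyLowerTail` (stmt-CriticalPhenomena-4575) — the stub inequality and the crux from the S⁺-step (corollaries of `sPlus_induction_open`)

Support file (prover `prim-hp-5`, hull-port cell, gen 9; `--supports stmt-CriticalPhenomena-4575`).  No definitions, no named facts,
no sorries.  S⁺(w, B, q, c, x): `μ(1 ≤ |π(B)| ≤ j) + μ(|π(B)| = 0, |π(c)| ≤ j) + μ(x ~ B, |π(x)| ≤ j < |π(B)|) ≤ μ(|π(q)| ≤ j)` (every relay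
admissible for the glued observer up to its championship gap; memo OBSERVER-SET.md §23).  From the step hypothesis of
`Theorems.sPlus_induction_open` over the class of all graphs:
* `attachedChampion_of_sPlusStep` — `μ(1 ≤ N ≤ j) ≤ μ(|π(q)| ≤ j, 1 ≤ N)` (the registered stub `stub_attachedChampion`);
* `noHeavyLowerTail_of_sPlusStep` — the crux.
-/

noncomputable section

namespace Summit.CriticalPhenomena.PercolationContinuityZ3.Theorems

open MeasureTheory Set Literature.Probability.LatticeModels Literature.Probability.Percolation
open scoped Classical BigOperators

/-- **The attached-champion inequality from the S⁺-step.**  If the step of `sPlus_induction_open` holds for every weighted graph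
(class `C` = all graphs), then `μ(1 ≤ N ≤ j) ≤ μ(|π(q)| ≤ j, 1 ≤ N)` for every observer `o ∉ A` and champion `q`
(= the registered stub `stub_attachedChampion`): S⁺ at `B = {o}`, `c = x = q`. [cite: KozmaNitzan2024, Lemma 5 (p. 13)] -/
theorem attachedChampion_of_sPlusStep
    (hStep : ∀ (n : ℕ) (w : Sym2 (Fin n) → unitInterval) (A B : Finset (Fin n)) (q c x : Fin n) (j : ℕ),
      (∀ (n' : ℕ) (w' : Sym2 (Fin n') → unitInterval) (A' B' : Finset (Fin n')) (q' c' x' : Fin n') (j' : ℕ),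
        ((Finset.univ.filter fun e : Sym2 (Fin n') => w' e ≠ 0).card < (Finset.univ.filter fun e : Sym2 (Fin n) => w e ≠ 0).card ∨
          ((Finset.univ.filter fun e : Sym2 (Fin n') => w' e ≠ 0).card ≤ (Finset.univ.filter fun e : Sym2 (Fin n) => w e ≠ 0).card ∧ B'.card < B.card)) →
        q' ∈ A' → c' ∈ A' → x' ∈ A' → B'.Nonempty → (∀ y ∈ B', y ∉ A') →
        (∀ a ∈ A', (prodBernoulli w').real {ω : BondConfig (Fin n') | (A'.filter fun x => ω ∈ openConn a x).card ≤ j'} ≤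
          (prodBernoulli w').real {ω : BondConfig (Fin n') | (A'.filter fun x => ω ∈ openConn q' x).card ≤ j'}) →
        (prodBernoulli w').real {ω : BondConfig (Fin n') | 1 ≤ (A'.filter fun z => ∃ y ∈ B', ω ∈ openConn y z).card ∧
            (A'.filter fun z => ∃ y ∈ B', ω ∈ openConn y z).card ≤ j'} +
          (prodBernoulli w').real {ω : BondConfig (Fin n') | ¬ 1 ≤ (A'.filter fun z => ∃ y ∈ B', ω ∈ openConn y z).card ∧
            (A'.filter fun z => ω ∈ openConn c' z).card ≤ j'} +
          (prodBernoulli w').real {ω : BondConfig (Fin n') | (∃ y ∈ B', ω ∈ openConn x' y) ∧ (A'.filter fun z => ω ∈ openConn x' z).card ≤ j' ∧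
            ¬ (A'.filter fun z => ∃ y ∈ B', ω ∈ openConn y z).card ≤ j'} ≤
        (prodBernoulli w').real {ω : BondConfig (Fin n') | (A'.filter fun z => ω ∈ openConn q' z).card ≤ j'}) →
      q ∈ A → c ∈ A → x ∈ A → 2 ≤ B.card → (∀ y ∈ B, y ∉ A) →
      (∀ a ∈ A, (prodBernoulli w).real {ω : BondConfig (Fin n) | (A.filter fun x => ω ∈ openConn a x).card ≤ j} ≤
          (prodBernoulli w).real {ω : BondConfig (Fin n) | (A.filter fun x => ω ∈ openConn q x).card ≤ j}) →
      (prodBernoulli w).real {ω : BondConfig (Fin n) | 1 ≤ (A.filter fun z => ∃ y ∈ B, ω ∈ openConn y z).card ∧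
            (A.filter fun z => ∃ y ∈ B, ω ∈ openConn y z).card ≤ j} +
          (prodBernoulli w).real {ω : BondConfig (Fin n) | ¬ 1 ≤ (A.filter fun z => ∃ y ∈ B, ω ∈ openConn y z).card ∧
            (A.filter fun z => ω ∈ openConn c z).card ≤ j} +
          (prodBernoulli w).real {ω : BondConfig (Fin n) | (∃ y ∈ B, ω ∈ openConn x y) ∧ (A.filter fun z => ω ∈ openConn x z).card ≤ j ∧
            ¬ (A.filter fun z => ∃ y ∈ B, ω ∈ openConn y z).card ≤ j} ≤
        (prodBernoulli w).real {ω : BondConfig (Fin n) | (A.filter fun z => ω ∈ openConn q z).card ≤ j})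
    (n : ℕ) (w : Sym2 (Fin n) → unitInterval) (A : Finset (Fin n)) (o q : Fin n) (j : ℕ) (ho : o ∉ A) (hq : q ∈ A)
    (hchamp : ∀ a ∈ A,
      (prodBernoulli w).real {ω : BondConfig (Fin n) | (A.filter fun x => ω ∈ openConn a x).card ≤ j} ≤
        (prodBernoulli w).real {ω : BondConfig (Fin n) | (A.filter fun x => ω ∈ openConn q x).card ≤ j}) :
    (prodBernoulli w).real {ω : BondConfig (Fin n) |
        1 ≤ (A.filter fun x => ω ∈ openConn o x).card ∧ (A.filter fun x => ω ∈ openConn o x).card ≤ j} ≤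
      (prodBernoulli w).real {ω : BondConfig (Fin n) |
        (A.filter fun x => ω ∈ openConn q x).card ≤ j ∧ 1 ≤ (A.filter fun x => ω ∈ openConn o x).card} := by
  haveI : IsProbabilityMeasure (prodBernoulli w) := inferInstance
  set μ := prodBernoulli w with hμ
  -- S⁺(w, {o}, q, q, q) from the induction over the class of all graphs
  have h := sPlus_induction_open (fun _ _ _ => True) (fun _ _ _ _ _ => trivial)
    (fun n w A B q c x j _ ih hq hc hx hB hBA hch =>
      hStep n w A B q c x j (fun n' w' A' B' q' c' x' j' hlt hq' hc' hx' hB' hBA' hch' =>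
        ih n' w' A' B' q' c' x' j' hlt trivial hq' hc' hx' hB' hBA' hch') hq hc hx hB hBA hch)
    ((Finset.univ.filter fun e : Sym2 (Fin n) => w e ≠ 0).card) 1 n w A {o} q q q j le_rfl (by simp) trivial hq hq hq
    ⟨o, Finset.mem_singleton_self o⟩ (fun y hy => by rw [Finset.mem_singleton.1 hy]; exact ho) hchamp
  set Nx : Fin n → BondConfig (Fin n) → ℕ := fun x ω => (A.filter fun z => ω ∈ openConn x z).card with hNx
  -- `|π({o})| = |π(o)|`
  have hNo : ∀ ω : BondConfig (Fin n), (A.filter fun z => ∃ y ∈ ({o} : Finset (Fin n)), ω ∈ openConn y z).card = Nx o ω := by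
    intro ω
    simp only [hNx]
    congr 1
    refine Finset.filter_congr fun z _ => ⟨fun ⟨x, hx, hxz⟩ => ?_, fun h => ⟨o, Finset.mem_singleton_self o, h⟩⟩
    rw [Finset.mem_singleton.1 hx] at hxz; exact hxz
  have eL : {ω : BondConfig (Fin n) | 1 ≤ (A.filter fun z => ∃ y ∈ ({o} : Finset (Fin n)), ω ∈ openConn y z).card ∧
        (A.filter fun z => ∃ y ∈ ({o} : Finset (Fin n)), ω ∈ openConn y z).card ≤ j} = {ω : BondConfig (Fin n) | 1 ≤ Nx o ω ∧ Nx o ω ≤ j} := by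
    ext ω; simp only [mem_setOf_eq, hNo]
  have eZ : {ω : BondConfig (Fin n) | ¬ 1 ≤ (A.filter fun z => ∃ y ∈ ({o} : Finset (Fin n)), ω ∈ openConn y z).card ∧
        (A.filter fun z => ω ∈ openConn q z).card ≤ j} = {ω : BondConfig (Fin n) | Nx q ω ≤ j} \ {ω | 1 ≤ Nx o ω} := by
    ext ω
    simp only [mem_sdiff, mem_setOf_eq, hNo]
    exact and_comm
  rw [eL, eZ] at h
  have h0 : 0 ≤ μ.real {ω : BondConfig (Fin n) | (∃ y ∈ ({o} : Finset (Fin n)), ω ∈ openConn q y) ∧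
      (A.filter fun z => ω ∈ openConn q z).card ≤ j ∧ ¬ (A.filter fun z => ∃ y ∈ ({o} : Finset (Fin n)), ω ∈ openConn y z).card ≤ j} :=
    measureReal_nonneg
  have hsplitA := measureReal_inter_add_sdiff (μ := μ) (s := {ω : BondConfig (Fin n) | Nx q ω ≤ j})
    (MeasurableSet.of_discrete (s := {ω : BondConfig (Fin n) | 1 ≤ Nx o ω})) (measure_ne_top _ _)
  have es1 : {ω : BondConfig (Fin n) | Nx q ω ≤ j} ∩ {ω | 1 ≤ Nx o ω} = {ω | Nx q ω ≤ j ∧ 1 ≤ Nx o ω} := by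
    ext ω; simp only [mem_inter_iff, mem_setOf_eq]
  rw [es1] at hsplitA
  change μ.real {ω | 1 ≤ Nx o ω ∧ Nx o ω ≤ j} ≤ μ.real {ω | Nx q ω ≤ j ∧ 1 ≤ Nx o ω}
  change μ.real {ω | 1 ≤ Nx o ω ∧ Nx o ω ≤ j} + μ.real ({ω : BondConfig (Fin n) | Nx q ω ≤ j} \ {ω | 1 ≤ Nx o ω}) + _ ≤ μ.real {ω | Nx q ω ≤ j} at h
  linarith

/-- **The crux from the S⁺-step** (`NoHeavyLowerTail` ⟸ `hStep`): if, for every weighted graph, champion `q`, relays `c, x` and every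
set `B` of at least two non-relay vertices, S⁺(w, B, q, c, x) follows from S⁺ (all champions, fallbacks, relays) at every nonempty
non-relay set of every graph with fewer positive pairs and at every smaller set of every graph with at most as many positive pairs,
then `NoHeavyLowerTail` holds. [cite: KozmaNitzan2024, Lemma 5 (p. 13)] -/
theorem noHeavyLowerTail_of_sPlusStep
    (hStep : ∀ (n : ℕ) (w : Sym2 (Fin n) → unitInterval) (A B : Finset (Fin n)) (q c x : Fin n) (j : ℕ),
      (∀ (n' : ℕ) (w' : Sym2 (Fin n') → unitInterval) (A' B' : Finset (Fin n')) (q' c' x' : Fin n') (j' : ℕ),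
        ((Finset.univ.filter fun e : Sym2 (Fin n') => w' e ≠ 0).card < (Finset.univ.filter fun e : Sym2 (Fin n) => w e ≠ 0).card ∨
          ((Finset.univ.filter fun e : Sym2 (Fin n') => w' e ≠ 0).card ≤ (Finset.univ.filter fun e : Sym2 (Fin n) => w e ≠ 0).card ∧ B'.card < B.card)) →
        q' ∈ A' → c' ∈ A' → x' ∈ A' → B'.Nonempty → (∀ y ∈ B', y ∉ A') →
        (∀ a ∈ A', (prodBernoulli w').real {ω : BondConfig (Fin n') | (A'.filter fun x => ω ∈ openConn a x).card ≤ j'} ≤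
          (prodBernoulli w').real {ω : BondConfig (Fin n') | (A'.filter fun x => ω ∈ openConn q' x).card ≤ j'}) →
        (prodBernoulli w').real {ω : BondConfig (Fin n') | 1 ≤ (A'.filter fun z => ∃ y ∈ B', ω ∈ openConn y z).card ∧
            (A'.filter fun z => ∃ y ∈ B', ω ∈ openConn y z).card ≤ j'} +
          (prodBernoulli w').real {ω : BondConfig (Fin n') | ¬ 1 ≤ (A'.filter fun z => ∃ y ∈ B', ω ∈ openConn y z).card ∧
            (A'.filter fun z => ω ∈ openConn c' z).card ≤ j'} +
          (prodBernoulli w').real {ω : BondConfig (Fin n') | (∃ y ∈ B', ω ∈ openConn x' y) ∧ (A'.filter fun z => ω ∈ openConn x' z).card ≤ j' ∧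
            ¬ (A'.filter fun z => ∃ y ∈ B', ω ∈ openConn y z).card ≤ j'} ≤
        (prodBernoulli w').real {ω : BondConfig (Fin n') | (A'.filter fun z => ω ∈ openConn q' z).card ≤ j'}) →
      q ∈ A → c ∈ A → x ∈ A → 2 ≤ B.card → (∀ y ∈ B, y ∉ A) →
      (∀ a ∈ A, (prodBernoulli w).real {ω : BondConfig (Fin n) | (A.filter fun x => ω ∈ openConn a x).card ≤ j} ≤
          (prodBernoulli w).real {ω : BondConfig (Fin n) | (A.filter fun x => ω ∈ openConn q x).card ≤ j}) →
      (prodBernoulli w).real {ω : BondConfig (Fin n) | 1 ≤ (A.filter fun z => ∃ y ∈ B, ω ∈ openConn y z).card ∧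
            (A.filter fun z => ∃ y ∈ B, ω ∈ openConn y z).card ≤ j} +
          (prodBernoulli w).real {ω : BondConfig (Fin n) | ¬ 1 ≤ (A.filter fun z => ∃ y ∈ B, ω ∈ openConn y z).card ∧
            (A.filter fun z => ω ∈ openConn c z).card ≤ j} +
          (prodBernoulli w).real {ω : BondConfig (Fin n) | (∃ y ∈ B, ω ∈ openConn x y) ∧ (A.filter fun z => ω ∈ openConn x z).card ≤ j ∧
            ¬ (A.filter fun z => ∃ y ∈ B, ω ∈ openConn y z).card ≤ j} ≤
        (prodBernoulli w).real {ω : BondConfig (Fin n) | (A.filter fun z => ω ∈ openConn q z).card ≤ j}) :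
    Summit.CriticalPhenomena.PercolationContinuityZ3.Theses.PercNearOneGluing.NoHeavyLowerTail :=
  noHeavyLowerTail_of_attachedChampion fun n w A o q j ho hq hchamp =>
    attachedChampion_of_sPlusStep hStep n w A o q j ho hq hchamp

end Summit.CriticalPhenomena.PercolationContinuityZ3.Theorems

end
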